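import Summits.BirchSwinnertonDyer.BirchSwinnertonDyer.Theorems.PrintCFramBottomClassIndexLawFiveLeBorelOLinearConjugation
import HarnessLib

/-!
# Route `PrintCFram`, crux C2 `BottomClassIndexLawFiveLe` (stmt-BirchSwinnertonDyer-20372), line
# `eisenstein-resource-bdp-line` (S2 `stub_kolyvaginUpper_borelCM_pairSum_offKrizLi`, targets for
# the `𝓞`-linear McCallum character): **`τ`-eigenvectors at every `𝔭`-adic depth** —
# `τ(ψ^k t) = (−1)^k ν · ψ^k t` for a `ν`-eigenvector `t` of the lift of complex conjugation
# (cell `bsd-print-cfram`, seat `bsd-line-cfram-p1-w2` g5; helper `--supports` 20372; 0 facts, 0 defs)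

HONEST FRAMING. Nothing about BSD is proved here, and nothing of S2 itself. DESIGN NOTE for the
`𝓞`-linear recast of McCallum's Prop. 3.1 / the Čebotarev kernel form at the Borel CM prime (the one
link of the machine not ported by this seat): work over `F = K·K'' ∋ √−p`; the classes form an
`𝓞 = ℤ[√−p]`-module `C = 𝓞·g ⊕ 𝓞T` (`μ_*` exists and is compatible with `[·,·]`, file 15; it swaps
the `±`-eigenspaces of `σ_*`, file 16); McCallum's character must be `𝓞`-LINEAR,
`φ : C/𝓞T ≅ 𝓞/𝔭^f → W[p^M]`, `ḡ ↦ e` with `ann(e) = 𝔭^f` and `τ e = ν e` for `σ_* g = ν g`; then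
AUTOMATICALLY `φ(μ_* g) = μ e` is a `(−ν)`-eigenvector (file 13) and McCallum's evaluation formula
`[g', (τ⁻¹ρτ)ρ] = ν' τ φ(g') + φ(g') = 2φ(g')` holds for BOTH `g' = g` and `g' = μ_* g` from the single
choice `[g, ρ] = e` (file 8e/15 supply `ρ`). This file provides the targets: from one `ν`-eigenvector
`t` (the tree's `IsLiftOfAut.exists_eigenvector_pow`, order `p^M`, i.e. `𝔭`-depth `2M` or `2M−1`)
the iterates `ψ^k t` are eigenvectors of sign `(−1)^k ν` at every lower depth:
* `iterate_map_zsmul` (iterates of an additive map commute with `ℤ`-scalars),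
* **`torsionMap_iterate_eq_of_eigen`**: `τ(ψ^k t) = ((−1)^k ν) · ψ^k t` whenever `τ t = ν t`, for any
  additive `ψ` on `W(F̄)[n]` agreeing with `μ` through `θ` (from `τψ + ψτ = 0`, file 16).
THEOREMS ONLY; no definition, no named fact, no `sorry`. BSD is not proved by any of this; no summit
statement is proved by this seat.
References: [McCallumLMS1991] §3 (E^±, Prop. 3.1); [GrossLMS1991] §5; [Rubin1999] Cor. 5.5.
-/

set_option autoImplicit false
-- `…BirchSwinnertonDyer.BirchSwinnertonDyer.Theorems…` is the problem's mandated namespace (D-0017).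
set_option linter.dupNamespace false

noncomputable section

open scoped Classical

namespace Summit.BirchSwinnertonDyer.BirchSwinnertonDyer.Theorems.PrintCFram.BorelKolyvaginPairing

open WeierstrassCurve Field Literature.NumberTheory.EllipticCurves
  Literature.NumberTheory.EllipticCurves.KolyvaginPairing Literature.NumberTheory.GaloisRepresentations
  Literature.NumberTheory.EllipticCurves.Rank1Residual
  Summit.BirchSwinnertonDyer.BirchSwinnertonDyer.Theorems.PrintCFram.BorelHomothety

section Targets

variable (W : WeierstrassCurve ℚ) [W.IsElliptic] (p : ℕ) [hp : Fact p.Prime]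
variable (F : Type) [Field F] [NumberField F]
variable {σ : F ≃ₐ[ℚ] F} {τ : AlgebraicClosure F ≃+* AlgebraicClosure F} {c₀ : absoluteGaloisGroup ℚ}

omit [W.IsElliptic] hp in
/-- Iterates of an additive endomorphism commute with integer scalars. [folklore] -/
theorem iterate_map_zsmul {A : Type*} [AddCommGroup A] (ψ : A →+ A) (k : ℕ) (c : ℤ) (a : A) :
    ψ^[k] (c • a) = c • ψ^[k] a := by
  induction k generalizing a with
  | zero => rfl
  | succ k ih => rw [Function.iterate_succ_apply, Function.iterate_succ_apply, map_zsmul, ih]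

omit [W.IsElliptic] in
/-- **`τ(ψ^k t) = (−1)^k ν · ψ^k t`.** For the lift `τ` of `σ` through a complex conjugation `c₀`, `ψ`
an additive map on `W(F̄)[n]` agreeing with `μ = √−p` through `θ`, and a `ν`-eigenvector `t` of `τ`:
the iterates `ψ^k t` are eigenvectors of sign `(−1)^k ν` — targets of every `𝔭`-adic depth and
either sign for an `𝓞`-linear McCallum character. [cite: McCallumLMS1991, §3 (E^±)] [cite: Rubin1999, Cor. 5.5] -/
theorem torsionMap_iterate_eq_of_eigen (hτ : IsLiftOfAut σ τ)
    (hγ : ∀ x, τ x = absGaloisTransport (K := ℚ) (L := F) c₀ x)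
    (hc₀ : IsComplexConjugation (Rat.castHom ℝ) c₀) {s : AlgebraicClosure ℚ}
    {μ : AddMonoid.End W.geomPoints} (hs : s ^ 2 = ((-(p : ℤ) : ℤ) : AlgebraicClosure ℚ))
    (hanti : ∀ g : absoluteGaloisGroup ℚ, g • s = -s → ∀ P, μ (g • P) = -(g • μ P))
    {n : ℤ} (ψ : geomTorsion (W.baseChange F) n →+ geomTorsion (W.baseChange F) n)
    (hψ : ∀ t, (((RatClosure.torsionEquiv (K := F) W n).symm (ψ t) : W.geomTorsion n) : W.geomPoints) =
      μ ((RatClosure.torsionEquiv (K := F) W n).symm t : W.geomTorsion n))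
    {ν : ℤ} {t : geomTorsion (W.baseChange F) n} (ht : hτ.torsionMap W n t = ν • t) (k : ℕ) :
    hτ.torsionMap W n (ψ^[k] t) = ((-1) ^ k * ν) • ψ^[k] t := by
  induction k with
  | zero => simpa using ht
  | succ k ih =>
    have h := torsionMap_apply_add_apply_torsionMap W p F hτ hγ hc₀ hs hanti ψ hψ (ψ^[k] t)
    rw [ih, map_zsmul] at h
    rw [Function.iterate_succ_apply', eq_neg_of_add_eq_zero_left h, pow_succ, ← neg_zsmul]
    congr 1
    ring

end Targets

end Summit.BirchSwinnertonDyer.BirchSwinnertonDyer.Theorems.PrintCFram.BorelKolyvaginPairing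

end
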